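import Mathlib
import Summits.MatrixMultiplication.MatrixMultiplication.Theses.FidelityWitnesses
import Summits.MatrixMultiplication.MatrixMultiplication.Theorems.FidelityWitnessesFidelityThesisSepMajorantSingleProduct
import Summits.MatrixMultiplication.MatrixMultiplication.Theorems.FidelityWitnessesFidelityThesisStubSeparableMajorantLaw
import Summits.MatrixMultiplication.MatrixMultiplication.Theorems.FidelityWitnessesFidelityThesisStubFrameConditioningLaw
import Literature.Computability.AlgebraicComplexity.AlderStrassen

/-!
# Line `Sketch` (separable-majorant) for crux `FidelityWitnesses.FidelityThesis` (stmt-MatrixMultiplication-4956) —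
the TRANSFER, kernel-checked, factored through n-FREE FIDELITY GROWTH

Conventions as in toolkit I (`Theorems/FidelityWitnessesFidelityThesisSepMajorantSingleProduct.lean`): slots
`a = (κ,ν)` (output), `b = (κ,μ)`, `c = (μ',ν)` in `Fin n × Fin n`; a rank-`≤ r` tensor is `S = Σ_{l<r} w_l ⊗ u_l ⊗ v_l`
with INPUT product frame `{u_l ⊗ v_l}`; `M(n,r) := sup {|⟨S,⟨n,n,n⟩⟩|²/‖S‖² : R(S) ≤ r}`.

The line's composition `FidelityThesis_of` (skeleton `Cruxes/FidelityThesis/Lines/Sketch.lean`) factors as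

  ROBUSTNESS GROWTH(δ′)  ⟹  FIDELITY GROWTH(δ′)  ⟹  `FidelityThesis` (δ = 4δ′/(3−2δ′), ε = ½),

where (all hypotheses are SPELLED OUT below, never named as facts):
* ROBUSTNESS GROWTH at `(δ′, C)` — the line's one OPEN stub (`stub_robustnessGrowth`; idea card
  `Cruxes/FidelityThesis/Ideas/separable-majorant-law.md` § Transfer, `Λ(r) ≤ C·r^{3/2−δ′}`): every span of `r` products
  `u_l ⊗ v_l ⊂ ℂ^{n×n} ⊗ ℂ^{n×n}` is majorised by `λ·σ`, `σ = Σ_k p_k (φ_k⊗ψ_k)(φ_k⊗ψ_k)^*` sub-normalised separable,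
  `λ ≤ C r^{3/2−δ′}`, in the projector-free form consumed by the landed `stub_separableMajorantLaw`.  (Ambient spaces
  `ℂ^{n×n}` lose nothing: `ℂ^N ↪ ℂ^{n×n}` isometrically for `n² ≥ N`, and compressing a separable majorant by `Q ⊗ Q`
  keeps it separable and sub-normalised — this is the card's `RobustnessGrowth(δ′)` exactly.)
* FIDELITY GROWTH at `(δ′, C)` — NEW intermediate node, n-free and mechanism-free: `M(n,r) ≤ C·r^{3/2−δ′}` for ALL
  `n, r`, i.e. `|⟨S,⟨n,n,n⟩⟩|² ≤ C r^{3/2−δ′} ‖S‖²` whenever `R(S) ≤ r`.  Calibration: `M(n,r) ≥ r` (partial standard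
  algorithm) and `M(m, R(⟨m,m,m⟩)) = m³ = r^{3/ω_m}` (exact schemes), so it forces `3/ω ≤ 3/2 − δ′`; the critical
  exponent `3/2` is the realignment ceiling (`‖P_E^Γ‖₁ ≤ r^{3/2}` for `r`-product spans; sibling crux
  `DiagonalPowerDecay`, whose statement is PRECISELY fidelity growth on the diagonal `r = n²`:
  `diagonalPowerDecay_of_fidelityGrowth` below).
Theorems:
* `fidelityThesis_curve_of_fidelityGrowthAt`, `fidelityThesis_of_fidelityGrowth`: FG ⇒ the crux's gap inequality
  along `r ≤ c·n^{2+δ}`, `δ = 4δ′/(3−2δ′)`, `c = (1/(2C))^{1/(3/2−δ′)}`, `ε = ½` (so `(2+δ)(3/2−δ′) = 3`) ⇒ `FidelityThesis`.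
* `fidelityGrowthAt_of_robustnessGrowthAt`: RG ⇒ FG with the same `(δ′, C)` — the separable majorant law's whole role.
* `fidelityThesis_curve_of_robustnessGrowthAt`, `fidelityThesis_of_robustnessGrowth`: the compositions (the
  skeleton's `FidelityThesis_of` with its open stub as an explicit hypothesis).
* `diagonalPowerDecay_of_fidelityGrowth`: FG(δ′) ⇒ the sibling crux `DiagonalPowerDecay` with `δ = δ′` (`r = n²`).
* `fidelityThesis_wellConditioned`: the crux's inequality, for EVERY `n`, on schemes whose input frame has normalised
  Gram `≥ A` and `r ≤ (A/2)·n^{2+δ}`, `δ ≤ 1` (landed `stub_frameConditioningLaw`; card § (2): every violator along a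
  superquadratic curve is polynomially ill-conditioned as a frame).
(Companion `…SepMajorantWindow.lean`: FG/RG at `δ′` ⇒ `2 + 4δ′/(3−2δ′) ≤ ω(ℂ)`; no `δ′ ≥ 0.236` can hold.)

Supports item `stmt-MatrixMultiplication-4956`; no definitions.
-/

namespace Summit.MatrixMultiplication.MatrixMultiplication.Theorems

open scoped BigOperators ComplexConjugate
open Literature.Computability.AlgebraicComplexity
open Summit.MatrixMultiplication.MatrixMultiplication.Theses.FidelityWitnesses (FidelityThesis DiagonalPowerDecay)

/-- A tensor of rank `≤ r` is, entrywise, a sum of `r` triads `Σ_l w_l(a) u_l(b) v_l(c)`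
(`exists_eq_sum_triad_of_tensorRank_le`, padding with zero triads). [folklore] -/
theorem sepMajorant_exists_frame {n r : ℕ} (S : Fin n × Fin n → Fin n × Fin n → Fin n × Fin n → ℂ)
    (hS : tensorRank S ≤ r) :
    ∃ w u v : Fin r → Fin n × Fin n → ℂ, ∀ a b c, S a b c = ∑ l, w l a * u l b * v l c := by
  obtain ⟨w, u, v, h⟩ := exists_eq_sum_triad_of_tensorRank_le hS
  refine ⟨w, u, v, fun a b c => ?_⟩
  have h' := congrFun (congrFun (congrFun h a) b) c
  rw [h']
  simp only [Finset.sum_apply, triad_apply]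

/-! ## Fidelity growth ⇒ the crux -/

/-- **n-FREE FIDELITY GROWTH at `(δ′, C)` ⇒ the crux's gap inequality along the whole superquadratic curve**
`r ≤ c·n^{2+δ}`, with `δ := 4δ′/(3−2δ′)`, `c := (1/(2C))^{1/(3/2−δ′)}` and the uniform constant `ε = ½`:
`|⟨S,T⟩|² ≤ C r^{3/2−δ′}‖S‖² ≤ C (c n^{2+δ})^{3/2−δ′}‖S‖² = C c^{3/2−δ′} n³ ‖S‖² = ½ n³ ‖S‖²`. -/
theorem fidelityThesis_curve_of_fidelityGrowthAt {δ' C : ℝ} (hδ'1 : δ' < 3 / 2) (hC : 0 < C)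
    (hFG : ∀ (n r : ℕ) (S : Fin n × Fin n → Fin n × Fin n → Fin n × Fin n → ℂ), tensorRank S ≤ r →
      ‖∑ a, ∑ b, ∑ c, S a b c * matMulTensor ℂ n n n a b c‖ ^ 2 ≤
        C * (r : ℝ) ^ (3 / 2 - δ') * ∑ a, ∑ b, ∑ c, ‖S a b c‖ ^ 2) :
    ∀ n r : ℕ, 1 ≤ n → (r : ℝ) ≤ (1 / (2 * C)) ^ (1 / (3 / 2 - δ')) * (n : ℝ) ^ (2 + 4 * δ' / (3 - 2 * δ')) →
      ∃ ε : ℝ, 0 < ε ∧ ∀ S : Fin n × Fin n → Fin n × Fin n → Fin n × Fin n → ℂ,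
        tensorRank S ≤ r →
          ‖∑ a, ∑ b, ∑ c, S a b c * matMulTensor ℂ n n n a b c‖ ^ 2 ≤
            (1 - ε) * (n : ℝ) ^ 3 * ∑ a, ∑ b, ∑ c, ‖S a b c‖ ^ 2 := by
  -- exponents and constants
  set e : ℝ := 3 / 2 - δ' with he
  have he0 : 0 < e := by rw [he]; linarith
  set δ : ℝ := 4 * δ' / (3 - 2 * δ') with hδ
  have h32 : 0 < 3 - 2 * δ' := by linarith
  have hexp : (2 + δ) * e = 3 := by
    rw [hδ, he]
    field_simp
    ring
  set c : ℝ := (1 / (2 * C)) ^ (1 / e) with hc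
  have hc0 : 0 < c := by rw [hc]; positivity
  have hce : C * c ^ e = 1 / 2 := by
    rw [hc, ← Real.rpow_mul (by positivity), one_div_mul_cancel he0.ne', Real.rpow_one]
    field_simp
  intro n r hn hr
  refine ⟨1 / 2, by norm_num, fun S hS => ?_⟩
  have hlaw := hFG n r S hS
  set N := ∑ a, ∑ b, ∑ c, ‖S a b c‖ ^ 2 with hN
  have hNnn : 0 ≤ N := by
    rw [hN]
    exact Finset.sum_nonneg fun a _ => Finset.sum_nonneg fun b _ =>
      Finset.sum_nonneg fun c _ => by positivity
  -- `C r^e ≤ C (c n^{2+δ})^e = ½ n³`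
  have hn0 : (0 : ℝ) < n := by exact_mod_cast hn
  have hr0 : (0 : ℝ) ≤ r := Nat.cast_nonneg r
  have hre : (r : ℝ) ^ e ≤ (c * (n : ℝ) ^ (2 + δ)) ^ e := Real.rpow_le_rpow hr0 hr he0.le
  have hsplit : (c * (n : ℝ) ^ (2 + δ)) ^ e = c ^ e * (n : ℝ) ^ 3 := by
    rw [Real.mul_rpow hc0.le (Real.rpow_nonneg hn0.le _), ← Real.rpow_mul hn0.le, hexp]
    norm_cast
  have hC3 : C * (r : ℝ) ^ (3 / 2 - δ') ≤ 1 / 2 * (n : ℝ) ^ 3 := by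
    calc C * (r : ℝ) ^ (3 / 2 - δ') = C * (r : ℝ) ^ e := by rw [he]
      _ ≤ C * (c * (n : ℝ) ^ (2 + δ)) ^ e := mul_le_mul_of_nonneg_left hre hC.le
      _ = C * c ^ e * (n : ℝ) ^ 3 := by rw [hsplit, mul_assoc]
      _ = 1 / 2 * (n : ℝ) ^ 3 := by rw [hce]
  calc ‖∑ a, ∑ b, ∑ c, S a b c * matMulTensor ℂ n n n a b c‖ ^ 2
      ≤ C * (r : ℝ) ^ (3 / 2 - δ') * N := hlaw
    _ ≤ 1 / 2 * (n : ℝ) ^ 3 * N := mul_le_mul_of_nonneg_right hC3 hNnn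
    _ = (1 - 1 / 2) * (n : ℝ) ^ 3 * N := by norm_num

/-- **n-FREE FIDELITY GROWTH ⇒ `FidelityThesis`**: if some `δ′ ∈ (0, 3/2)` and `C > 0` have `M(n,r) ≤ C·r^{3/2−δ′}`
for all `n, r` (`|⟨S,⟨n,n,n⟩⟩|² ≤ C r^{3/2−δ′}‖S‖²` whenever `R(S) ≤ r`), the crux holds with `δ = 4δ′/(3−2δ′)`,
`c = (1/(2C))^{1/(3/2−δ′)}`, `ε = ½`.  (The converse direction of the line: every mechanism certifying a uniform power
saving below the realignment ceiling `r^{3/2}` closes the crux.) -/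
theorem fidelityThesis_of_fidelityGrowth
    (hFG : ∃ δ' : ℝ, 0 < δ' ∧ δ' < 3 / 2 ∧ ∃ C : ℝ, 0 < C ∧
      ∀ (n r : ℕ) (S : Fin n × Fin n → Fin n × Fin n → Fin n × Fin n → ℂ), tensorRank S ≤ r →
        ‖∑ a, ∑ b, ∑ c, S a b c * matMulTensor ℂ n n n a b c‖ ^ 2 ≤
          C * (r : ℝ) ^ (3 / 2 - δ') * ∑ a, ∑ b, ∑ c, ‖S a b c‖ ^ 2) :
    FidelityThesis := by
  obtain ⟨δ', hδ'0, hδ'1, C, hC, h⟩ := hFG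
  have h32 : 0 < 3 - 2 * δ' := by linarith
  exact ⟨4 * δ' / (3 - 2 * δ'), by positivity, (1 / (2 * C)) ^ (1 / (3 / 2 - δ')), by positivity,
    fidelityThesis_curve_of_fidelityGrowthAt hδ'1 hC h⟩

/-- **n-FREE FIDELITY GROWTH on the diagonal `r = n²` is the sibling crux `DiagonalPowerDecay`**: FG at `(δ′, C)`
gives `|⟨S,⟨n,n,n⟩⟩|² ≤ C·(n²)^{3/2−δ′}‖S‖² = C·n^{3−2δ′}‖S‖²` for `R(S) ≤ n²`, i.e. `DiagonalPowerDecay` with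
`δ = δ′`. -/
theorem diagonalPowerDecay_of_fidelityGrowth
    (hFG : ∃ δ' : ℝ, 0 < δ' ∧ δ' < 3 / 2 ∧ ∃ C : ℝ, 0 < C ∧
      ∀ (n r : ℕ) (S : Fin n × Fin n → Fin n × Fin n → Fin n × Fin n → ℂ), tensorRank S ≤ r →
        ‖∑ a, ∑ b, ∑ c, S a b c * matMulTensor ℂ n n n a b c‖ ^ 2 ≤
          C * (r : ℝ) ^ (3 / 2 - δ') * ∑ a, ∑ b, ∑ c, ‖S a b c‖ ^ 2) :
    DiagonalPowerDecay := by
  obtain ⟨δ', hδ'0, -, C, -, h⟩ := hFG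
  refine ⟨C, δ', hδ'0, fun n S hS => ?_⟩
  have key := h n (n ^ 2) S hS
  have hn0 : (0 : ℝ) ≤ n := Nat.cast_nonneg n
  have hpow : (((n ^ 2 : ℕ)) : ℝ) ^ (3 / 2 - δ') = (n : ℝ) ^ (3 - 2 * δ') := by
    push_cast
    rw [show ((n : ℝ) ^ 2) = (n : ℝ) ^ (2 : ℝ) by norm_cast, ← Real.rpow_mul hn0]
    congr 1
    ring
  rw [hpow] at key
  exact key

/-! ## Robustness growth ⇒ fidelity growth (the separable majorant law's role) -/

/-- **ROBUSTNESS GROWTH ⇒ n-FREE FIDELITY GROWTH, same `(δ′, C)`**: write a rank-`≤ r` tensor as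
`Σ_{l<r} w_l ⊗ u_l ⊗ v_l` (`sepMajorant_exists_frame`), take the separable majorant of its input frame
(`λ ≤ C r^{3/2−δ′}`) and apply the separable majorant law (`stub_separableMajorantLaw`, landed):
`|⟨S,T⟩|² ≤ λ‖S‖² ≤ C r^{3/2−δ′}‖S‖²`.  This is `M(n,r) ≤ Λ(r)` of the idea card, in growth form. -/
theorem fidelityGrowthAt_of_robustnessGrowthAt {δ' C : ℝ} (hC : 0 < C)
    (hRG : ∀ (n r : ℕ) (u v : Fin r → Fin n × Fin n → ℂ),
      ∃ (m : ℕ) (p : Fin m → ℝ) (φ ψ : Fin m → Fin n × Fin n → ℂ) (lam : ℝ),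
        0 ≤ lam ∧ lam ≤ C * (r : ℝ) ^ (3 / 2 - δ') ∧ (∀ k, 0 ≤ p k) ∧
        (∑ k, p k * ((∑ b, ‖φ k b‖ ^ 2) * ∑ c, ‖ψ k c‖ ^ 2) ≤ 1) ∧
        ∀ (d : Fin r → ℂ) (z : Fin n × Fin n → Fin n × Fin n → ℂ),
          ‖∑ b, ∑ c, (∑ l, d l * u l b * v l c) * z b c‖ ^ 2 ≤
            lam * (∑ b, ∑ c, ‖∑ l, d l * u l b * v l c‖ ^ 2) *
              ∑ k, p k * ‖∑ b, ∑ c, φ k b * ψ k c * z b c‖ ^ 2)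
    (n r : ℕ) (S : Fin n × Fin n → Fin n × Fin n → Fin n × Fin n → ℂ) (hS : tensorRank S ≤ r) :
    ‖∑ a, ∑ b, ∑ c, S a b c * matMulTensor ℂ n n n a b c‖ ^ 2 ≤
      C * (r : ℝ) ^ (3 / 2 - δ') * ∑ a, ∑ b, ∑ c, ‖S a b c‖ ^ 2 := by
  obtain ⟨w, u, v, hSwuv⟩ := sepMajorant_exists_frame S hS
  have hSfun : S = fun a b c => ∑ l, w l a * u l b * v l c := by
    funext a b c; exact hSwuv a b c
  obtain ⟨m, p, φ, ψ, lam, hlam0, hlamle, hp, htr, hmaj⟩ := hRG n r u v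
  have hlaw := stub_separableMajorantLaw w u v p φ ψ lam hlam0 hp htr hmaj
  set N := ∑ a, ∑ b, ∑ c, ‖∑ l, w l a * u l b * v l c‖ ^ 2 with hN
  have hNnn : 0 ≤ N := by
    rw [hN]
    exact Finset.sum_nonneg fun a _ => Finset.sum_nonneg fun b _ =>
      Finset.sum_nonneg fun c _ => by positivity
  have hCpos : 0 ≤ C * (r : ℝ) ^ (3 / 2 - δ') := by positivity
  rw [hSfun]
  calc ‖∑ a, ∑ b, ∑ c, (∑ l, w l a * u l b * v l c) * matMulTensor ℂ n n n a b c‖ ^ 2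
      ≤ lam * N := hlaw
    _ ≤ C * (r : ℝ) ^ (3 / 2 - δ') * N := mul_le_mul_of_nonneg_right hlamle hNnn

/-- **ROBUSTNESS GROWTH at `(δ′, C)` ⇒ the crux's gap inequality along the curve `r ≤ c·n^{2+δ}`**,
`δ = 4δ′/(3−2δ′)`, `c = (1/(2C))^{1/(3/2−δ′)}`, `ε = ½` (composition of the two theorems above). -/
theorem fidelityThesis_curve_of_robustnessGrowthAt {δ' C : ℝ} (hδ'1 : δ' < 3 / 2) (hC : 0 < C)
    (hRG : ∀ (n r : ℕ) (u v : Fin r → Fin n × Fin n → ℂ),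
      ∃ (m : ℕ) (p : Fin m → ℝ) (φ ψ : Fin m → Fin n × Fin n → ℂ) (lam : ℝ),
        0 ≤ lam ∧ lam ≤ C * (r : ℝ) ^ (3 / 2 - δ') ∧ (∀ k, 0 ≤ p k) ∧
        (∑ k, p k * ((∑ b, ‖φ k b‖ ^ 2) * ∑ c, ‖ψ k c‖ ^ 2) ≤ 1) ∧
        ∀ (d : Fin r → ℂ) (z : Fin n × Fin n → Fin n × Fin n → ℂ),
          ‖∑ b, ∑ c, (∑ l, d l * u l b * v l c) * z b c‖ ^ 2 ≤
            lam * (∑ b, ∑ c, ‖∑ l, d l * u l b * v l c‖ ^ 2) *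
              ∑ k, p k * ‖∑ b, ∑ c, φ k b * ψ k c * z b c‖ ^ 2) :
    ∀ n r : ℕ, 1 ≤ n → (r : ℝ) ≤ (1 / (2 * C)) ^ (1 / (3 / 2 - δ')) * (n : ℝ) ^ (2 + 4 * δ' / (3 - 2 * δ')) →
      ∃ ε : ℝ, 0 < ε ∧ ∀ S : Fin n × Fin n → Fin n × Fin n → Fin n × Fin n → ℂ,
        tensorRank S ≤ r →
          ‖∑ a, ∑ b, ∑ c, S a b c * matMulTensor ℂ n n n a b c‖ ^ 2 ≤
            (1 - ε) * (n : ℝ) ^ 3 * ∑ a, ∑ b, ∑ c, ‖S a b c‖ ^ 2 :=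
  fidelityThesis_curve_of_fidelityGrowthAt hδ'1 hC (fidelityGrowthAt_of_robustnessGrowthAt hC hRG)

/-- **ROBUSTNESS GROWTH ⇒ `FidelityThesis`** — the composition `FidelityThesis_of` of line `Sketch`
(`Cruxes/FidelityThesis/Lines/Sketch.lean`) with its one open stub `stub_robustnessGrowth` as an explicit hypothesis:
from `(δ′, C)` the crux holds with `δ = 4δ′/(3−2δ′)`, `c = (1/(2C))^{1/(3/2−δ′)}`, `ε = ½`. -/
theorem fidelityThesis_of_robustnessGrowth
    (hRG : ∃ δ' : ℝ, 0 < δ' ∧ δ' < 3 / 2 ∧ ∃ C : ℝ, 0 < C ∧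
      ∀ (n r : ℕ) (u v : Fin r → Fin n × Fin n → ℂ),
        ∃ (m : ℕ) (p : Fin m → ℝ) (φ ψ : Fin m → Fin n × Fin n → ℂ) (lam : ℝ),
          0 ≤ lam ∧ lam ≤ C * (r : ℝ) ^ (3 / 2 - δ') ∧ (∀ k, 0 ≤ p k) ∧
          (∑ k, p k * ((∑ b, ‖φ k b‖ ^ 2) * ∑ c, ‖ψ k c‖ ^ 2) ≤ 1) ∧
          ∀ (d : Fin r → ℂ) (z : Fin n × Fin n → Fin n × Fin n → ℂ),
            ‖∑ b, ∑ c, (∑ l, d l * u l b * v l c) * z b c‖ ^ 2 ≤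
              lam * (∑ b, ∑ c, ‖∑ l, d l * u l b * v l c‖ ^ 2) *
                ∑ k, p k * ‖∑ b, ∑ c, φ k b * ψ k c * z b c‖ ^ 2) :
    FidelityThesis := by
  obtain ⟨δ', hδ'0, hδ'1, C, hC, h⟩ := hRG
  exact fidelityThesis_of_fidelityGrowth
    ⟨δ', hδ'0, hδ'1, C, hC, fidelityGrowthAt_of_robustnessGrowthAt hC h⟩

/-! ## A proved partial class: well-conditioned frames (card § Why it bites (2)) -/

/-- **The crux's inequality on A-well-conditioned frames, for every `n`** (from the landed
`stub_frameConditioningLaw`): if `0 < A`, `δ ≤ 1`, `1 ≤ n`, `r ≤ (A/2)·n^{2+δ}`, and `S = Σ_{l<r} w_l ⊗ u_l ⊗ v_l` has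
an input frame with normalised Gram `≥ A`, then `‖⟨S,⟨n,n,n⟩⟩‖² ≤ (1 − ½)·n³·‖S‖²`.  So `FidelityThesis` (indeed
with `δ = 1`) holds on the class of schemes whose product frames stay uniformly well-conditioned, and every violator
along a superquadratic curve `r = c·n^{2+δ}` is polynomially ill-conditioned as a frame. -/
theorem fidelityThesis_wellConditioned {A δ : ℝ} (hA : 0 < A) (hδ : δ ≤ 1) {n r : ℕ} (hn : 1 ≤ n)
    (hr : (r : ℝ) ≤ A / 2 * (n : ℝ) ^ (2 + δ)) (w u v : Fin r → Fin n × Fin n → ℂ)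
    (hframe : ∀ d : Fin r → ℂ,
      A * ∑ l, ‖d l‖ ^ 2 * ((∑ b, ‖u l b‖ ^ 2) * ∑ c, ‖v l c‖ ^ 2) ≤
        ∑ b, ∑ c, ‖∑ l, d l * u l b * v l c‖ ^ 2) :
    ‖∑ a, ∑ b, ∑ c, (∑ l, w l a * u l b * v l c) * matMulTensor ℂ n n n a b c‖ ^ 2 ≤
      (1 - 1 / 2) * (n : ℝ) ^ 3 * ∑ a, ∑ b, ∑ c, ‖∑ l, w l a * u l b * v l c‖ ^ 2 := by
  have hlaw := stub_frameConditioningLaw w u v A hA.le hframe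
  set X := ‖∑ a, ∑ b, ∑ c, (∑ l, w l a * u l b * v l c) * matMulTensor ℂ n n n a b c‖ ^ 2 with hX
  set N := ∑ a, ∑ b, ∑ c, ‖∑ l, w l a * u l b * v l c‖ ^ 2 with hN
  have hNnn : 0 ≤ N := by
    rw [hN]
    exact Finset.sum_nonneg fun a _ => Finset.sum_nonneg fun b _ =>
      Finset.sum_nonneg fun c _ => by positivity
  have hn1 : (1 : ℝ) ≤ n := by exact_mod_cast hn
  have hpow : (n : ℝ) ^ (2 + δ) ≤ (n : ℝ) ^ 3 := by
    have h3 : (n : ℝ) ^ (3 : ℝ) = (n : ℝ) ^ 3 := by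
      rw [show (3 : ℝ) = ((3 : ℕ) : ℝ) by norm_num, Real.rpow_natCast]
    rw [← h3]
    exact Real.rpow_le_rpow_of_exponent_le hn1 (by linarith)
  have h1 : A * X ≤ A / 2 * (n : ℝ) ^ 3 * N := by
    calc A * X ≤ (r : ℝ) * N := hlaw
      _ ≤ A / 2 * (n : ℝ) ^ (2 + δ) * N := mul_le_mul_of_nonneg_right hr hNnn
      _ ≤ A / 2 * (n : ℝ) ^ 3 * N := by
          apply mul_le_mul_of_nonneg_right _ hNnn
          exact mul_le_mul_of_nonneg_left hpow (by linarith)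
  have h2 : X ≤ 1 / 2 * (n : ℝ) ^ 3 * N := by
    have := mul_le_mul_of_nonneg_left h1 (inv_nonneg.2 hA.le)
    rw [← mul_assoc, inv_mul_cancel₀ hA.ne', one_mul] at this
    calc X ≤ A⁻¹ * (A / 2 * (n : ℝ) ^ 3 * N) := this
      _ = 1 / 2 * (n : ℝ) ^ 3 * N := by field_simp
  norm_num
  linarith

end Summit.MatrixMultiplication.MatrixMultiplication.Theorems
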